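import Summits.CriticalPhenomena.PercolationContinuityZ3.Theorems.PercNearOneGluingNoHeavyLowerTailCILUnionExchangeAvoidedDominance
import Summits.CriticalPhenomena.PercolationContinuityZ3.Theorems.PercNearOneGluingNoHeavyLowerTailCovTauAssembly
import HarnessLib

/-!
# `NoHeavyLowerTail` (stmt-CriticalPhenomena-4575) — DOM2 (Kozma–Nitzan's Theorem 1 with an avoided vertex) from the
# A2-diagonal hypothesis

Support file (`--supports stmt-CriticalPhenomena-4575`), prover `prim-gen-induct` (gen 10).  No definitions, no named
facts, no sorries; standard axioms.

`CovTau.covTau_of_diagonal` (…CovTauAssembly, the cell's COV(τ) from the A2-diagonal hypothesis `H`) specialised to the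
indicator of an upper family gives the event form of COV(τ) consumed by `UnionExchange.tsplit_of_cov` /
`pair_avoided_dominance_of_cov` (…CILUnionExchangeAvoidedDominance).  Hence:

* `UnionExchange.cov_event_of_diagonal` — event form of COV(τ): `Cov(𝒜, o∈C_s | s↮a) ≥ μ(o↔t | t↮s, t↮a)·Cov(𝒜, t∈C_s | s↮a)`
  (denominator-free) for every upper family `𝒜`, from `H` at `(x, y, o, v) = (s, a, o, t)`;
* `UnionExchange.pair_avoided_dominance_of_diagonal` — DOM2 with the avoided vertex `a` for the terminals `a₁, a₂` and the
  observer `o`, from `H` at `(a₁, a, o, a₂)` and at `(a₂, a, o, a₁)`: the `|W| = 2` avoided-vertex union exchange of the crux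
  line (BLOBQUOTIENT §25–28: DOM2 ⟹ UX ⟹ AUT(|W|=2) ⟹ RHLA(|B|=3)) holds modulo the single open Lean piece A2-diagonal.
[cite: KozmaNitzan2024, Thm. 1 (pp. 7–8)] [cite: VandenbergHaggstromKahn2005, Thms. 1.3–1.4 (pp. 6–7), §2.1 (pp. 9–13)]
-/

noncomputable section

open MeasureTheory Set
open Literature.Probability.LatticeModels (prodBernoulli)
open Literature.Probability.Percolation Literature.Probability.Percolation.KNPreFKG
open scoped Classical

namespace Summit.CriticalPhenomena.PercolationContinuityZ3.Theorems

namespace UnionExchange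

variable {V : Type*} [Fintype V]

/-- **Event form of COV(τ) from the A2-diagonal hypothesis** (at `(x, y, o, v) = (s, a, o, t)`): for every upper family `𝒜`,
`μ(t↮s, t↮a, t↔o)·cov_R(A, {s↔t}) ≤ μ(t↮s, t↮a)·cov_R(A, {s↔o})`, `R = {s↮a}`, `A = {C_s ∈ 𝒜}` — `CovTau.covTau_of_diagonal`
at `f = 1_𝒜`. [cite: VandenbergHaggstromKahn2005, Thms. 1.3–1.4 (pp. 6–7), §2.1 (pp. 9–13)] -/
theorem cov_event_of_diagonal (w : Sym2 V → unitInterval) (o s t a : V) (hts : t ≠ s)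
    (H : ∀ p : Sym2 V → unitInterval, (∀ e, 0 < p e ∧ p e < 1) →
      ∀ g : Set (Sym2 V) → ℝ, Monotone g → (∀ C, 0 ≤ g C) →
      (prodBernoulli p).real ({ω : BondConfig V | ¬ (openGraph ω).Reachable t s} ∩
          {ω | ¬ (openGraph ω).Reachable t a} ∩ openConn t o) *
        (∫ ω in {ω : BondConfig V | ¬ (openGraph ω).Reachable s a},
          ((∫ η in (openConn s t : Set (BondConfig V)), g (openEdgeCluster η s)
              ∂(prodBernoulli fun e => if (∃ u ∈ e, (openGraph ω).Reachable a u)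
                then (0 : unitInterval) else p e)) -
            (∫ η, g (openEdgeCluster η s)
              ∂(prodBernoulli fun e => if (∃ u ∈ e, (openGraph ω).Reachable a u)
                then (0 : unitInterval) else p e)) *
            (prodBernoulli fun e => if (∃ u ∈ e, (openGraph ω).Reachable a u)
                then (0 : unitInterval) else p e).real (openConn s t : Set (BondConfig V)))
          ∂(prodBernoulli p)) ≤
      (prodBernoulli p).real ({ω : BondConfig V | ¬ (openGraph ω).Reachable t s} ∩
          {ω | ¬ (openGraph ω).Reachable t a}) *
        (∫ ω in {ω : BondConfig V | ¬ (openGraph ω).Reachable s a},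
          ((prodBernoulli fun e => if (∃ u ∈ e, (openGraph ω).Reachable a u)
                then (0 : unitInterval) else p e).real
              ({η : BondConfig V | ¬ (openGraph η).Reachable t s} ∩ openConn t o) /
            (prodBernoulli fun e => if (∃ u ∈ e, (openGraph ω).Reachable a u)
                then (0 : unitInterval) else p e).real
              {η : BondConfig V | ¬ (openGraph η).Reachable t s}) *
          ((∫ η in (openConn s t : Set (BondConfig V)), g (openEdgeCluster η s)
              ∂(prodBernoulli fun e => if (∃ u ∈ e, (openGraph ω).Reachable a u)
                then (0 : unitInterval) else p e)) -
            (∫ η, g (openEdgeCluster η s)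
              ∂(prodBernoulli fun e => if (∃ u ∈ e, (openGraph ω).Reachable a u)
                then (0 : unitInterval) else p e)) *
            (prodBernoulli fun e => if (∃ u ∈ e, (openGraph ω).Reachable a u)
                then (0 : unitInterval) else p e).real (openConn s t : Set (BondConfig V)))
          ∂(prodBernoulli p)))
    {𝒜 : Set (Set (Sym2 V))} (h𝒜 : IsUpperSet 𝒜) :
      (prodBernoulli w).real ({ω : BondConfig V | ¬ (openGraph ω).Reachable t s} ∩
          {ω | ¬ (openGraph ω).Reachable t a} ∩ openConn t o) *
        ((prodBernoulli w).real {ω : BondConfig V | ¬ (openGraph ω).Reachable s a} *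
            (prodBernoulli w).real ({ω : BondConfig V | ¬ (openGraph ω).Reachable s a} ∩ openConn s t ∩
              {ω | openEdgeCluster ω s ∈ 𝒜}) -
          (prodBernoulli w).real ({ω : BondConfig V | ¬ (openGraph ω).Reachable s a} ∩ {ω | openEdgeCluster ω s ∈ 𝒜}) *
            (prodBernoulli w).real ({ω : BondConfig V | ¬ (openGraph ω).Reachable s a} ∩ openConn s t)) ≤
      (prodBernoulli w).real ({ω : BondConfig V | ¬ (openGraph ω).Reachable t s} ∩
          {ω | ¬ (openGraph ω).Reachable t a}) *
        ((prodBernoulli w).real {ω : BondConfig V | ¬ (openGraph ω).Reachable s a} *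
            (prodBernoulli w).real ({ω : BondConfig V | ¬ (openGraph ω).Reachable s a} ∩ openConn s o ∩
              {ω | openEdgeCluster ω s ∈ 𝒜}) -
          (prodBernoulli w).real ({ω : BondConfig V | ¬ (openGraph ω).Reachable s a} ∩ {ω | openEdgeCluster ω s ∈ 𝒜}) *
            (prodBernoulli w).real ({ω : BondConfig V | ¬ (openGraph ω).Reachable s a} ∩ openConn s o)) := by
  have h := CovTau.covTau_of_diagonal w s a o t hts H (𝒜.indicator 1) (monotone_indicator_one_of_isUpperSet h𝒜)
  rw [indicator_comp_openEdgeCluster] at h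
  simp only [setIntegral_indicator_one_eq] at h
  exact h

/-- **DOM2 (Kozma–Nitzan's Theorem 1 with an avoided vertex) from the A2-diagonal hypothesis** at the two quadruples
`(x, y, o, v) = (a₁, a, o, a₂)` and `(a₂, a, o, a₁)`: observer `o`, terminals `a₁ ≠ a₂`, avoided vertex `a ∉ {a₁, a₂}`; there is
ONE `θ ∈ [0,1]` such that for EVERY upper family `𝒜`, with `Oᵢ = {o↔aᵢ}`, `M = {a₁↔a₂}`, `Rᵢ = {aᵢ↮a}`, `D = {o↮a}`,
`Λ₁ = μ(R₁∩O₁∩Mᶜ) + θ μ(R₁∩O₁∩M)`, `Λ₂ = μ(R₂∩O₂∩Mᶜ) + (1−θ) μ(R₂∩O₂∩M)`: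
`Λ₁ μ(R₂) μ(R₁ ∩ {C_{a₁}∈𝒜}) + Λ₂ μ(R₁) μ(R₂ ∩ {C_{a₂}∈𝒜}) ≤ μ(R₁) μ(R₂) μ((O₁∪O₂) ∩ D ∩ {C_o∈𝒜})`.
(`pair_avoided_dominance_of_cov` + `cov_event_of_diagonal`.) [cite: KozmaNitzan2024, Thm. 1 (pp. 7–8)] -/
theorem pair_avoided_dominance_of_diagonal (w : Sym2 V → unitInterval) (o a₁ a₂ a : V) (h12 : a₁ ≠ a₂) (h1a : a₁ ≠ a)
    (h2a : a₂ ≠ a)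
    (H₁ : ∀ p : Sym2 V → unitInterval, (∀ e, 0 < p e ∧ p e < 1) →
      ∀ g : Set (Sym2 V) → ℝ, Monotone g → (∀ C, 0 ≤ g C) →
      (prodBernoulli p).real ({ω : BondConfig V | ¬ (openGraph ω).Reachable a₂ a₁} ∩
          {ω | ¬ (openGraph ω).Reachable a₂ a} ∩ openConn a₂ o) *
        (∫ ω in {ω : BondConfig V | ¬ (openGraph ω).Reachable a₁ a},
          ((∫ η in (openConn a₁ a₂ : Set (BondConfig V)), g (openEdgeCluster η a₁)
              ∂(prodBernoulli fun e => if (∃ u ∈ e, (openGraph ω).Reachable a u)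
                then (0 : unitInterval) else p e)) -
            (∫ η, g (openEdgeCluster η a₁)
              ∂(prodBernoulli fun e => if (∃ u ∈ e, (openGraph ω).Reachable a u)
                then (0 : unitInterval) else p e)) *
            (prodBernoulli fun e => if (∃ u ∈ e, (openGraph ω).Reachable a u)
                then (0 : unitInterval) else p e).real (openConn a₁ a₂ : Set (BondConfig V)))
          ∂(prodBernoulli p)) ≤
      (prodBernoulli p).real ({ω : BondConfig V | ¬ (openGraph ω).Reachable a₂ a₁} ∩
          {ω | ¬ (openGraph ω).Reachable a₂ a}) *
        (∫ ω in {ω : BondConfig V | ¬ (openGraph ω).Reachable a₁ a},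
          ((prodBernoulli fun e => if (∃ u ∈ e, (openGraph ω).Reachable a u)
                then (0 : unitInterval) else p e).real
              ({η : BondConfig V | ¬ (openGraph η).Reachable a₂ a₁} ∩ openConn a₂ o) /
            (prodBernoulli fun e => if (∃ u ∈ e, (openGraph ω).Reachable a u)
                then (0 : unitInterval) else p e).real
              {η : BondConfig V | ¬ (openGraph η).Reachable a₂ a₁}) *
          ((∫ η in (openConn a₁ a₂ : Set (BondConfig V)), g (openEdgeCluster η a₁)
              ∂(prodBernoulli fun e => if (∃ u ∈ e, (openGraph ω).Reachable a u)
                then (0 : unitInterval) else p e)) -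
            (∫ η, g (openEdgeCluster η a₁)
              ∂(prodBernoulli fun e => if (∃ u ∈ e, (openGraph ω).Reachable a u)
                then (0 : unitInterval) else p e)) *
            (prodBernoulli fun e => if (∃ u ∈ e, (openGraph ω).Reachable a u)
                then (0 : unitInterval) else p e).real (openConn a₁ a₂ : Set (BondConfig V)))
          ∂(prodBernoulli p)))
    (H₂ : ∀ p : Sym2 V → unitInterval, (∀ e, 0 < p e ∧ p e < 1) →
      ∀ g : Set (Sym2 V) → ℝ, Monotone g → (∀ C, 0 ≤ g C) →
      (prodBernoulli p).real ({ω : BondConfig V | ¬ (openGraph ω).Reachable a₁ a₂} ∩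
          {ω | ¬ (openGraph ω).Reachable a₁ a} ∩ openConn a₁ o) *
        (∫ ω in {ω : BondConfig V | ¬ (openGraph ω).Reachable a₂ a},
          ((∫ η in (openConn a₂ a₁ : Set (BondConfig V)), g (openEdgeCluster η a₂)
              ∂(prodBernoulli fun e => if (∃ u ∈ e, (openGraph ω).Reachable a u)
                then (0 : unitInterval) else p e)) -
            (∫ η, g (openEdgeCluster η a₂)
              ∂(prodBernoulli fun e => if (∃ u ∈ e, (openGraph ω).Reachable a u)
                then (0 : unitInterval) else p e)) *
            (prodBernoulli fun e => if (∃ u ∈ e, (openGraph ω).Reachable a u)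
                then (0 : unitInterval) else p e).real (openConn a₂ a₁ : Set (BondConfig V)))
          ∂(prodBernoulli p)) ≤
      (prodBernoulli p).real ({ω : BondConfig V | ¬ (openGraph ω).Reachable a₁ a₂} ∩
          {ω | ¬ (openGraph ω).Reachable a₁ a}) *
        (∫ ω in {ω : BondConfig V | ¬ (openGraph ω).Reachable a₂ a},
          ((prodBernoulli fun e => if (∃ u ∈ e, (openGraph ω).Reachable a u)
                then (0 : unitInterval) else p e).real
              ({η : BondConfig V | ¬ (openGraph η).Reachable a₁ a₂} ∩ openConn a₁ o) /
            (prodBernoulli fun e => if (∃ u ∈ e, (openGraph ω).Reachable a u)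
                then (0 : unitInterval) else p e).real
              {η : BondConfig V | ¬ (openGraph η).Reachable a₁ a₂}) *
          ((∫ η in (openConn a₂ a₁ : Set (BondConfig V)), g (openEdgeCluster η a₂)
              ∂(prodBernoulli fun e => if (∃ u ∈ e, (openGraph ω).Reachable a u)
                then (0 : unitInterval) else p e)) -
            (∫ η, g (openEdgeCluster η a₂)
              ∂(prodBernoulli fun e => if (∃ u ∈ e, (openGraph ω).Reachable a u)
                then (0 : unitInterval) else p e)) *
            (prodBernoulli fun e => if (∃ u ∈ e, (openGraph ω).Reachable a u)
                then (0 : unitInterval) else p e).real (openConn a₂ a₁ : Set (BondConfig V)))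
          ∂(prodBernoulli p))) :
    ∃ θ : ℝ, 0 ≤ θ ∧ θ ≤ 1 ∧ ∀ 𝒜 : Set (Set (Sym2 V)), IsUpperSet 𝒜 →
      (prodBernoulli w).real {ω : BondConfig V | ¬ (openGraph ω).Reachable a₂ a} *
          ((prodBernoulli w).real ({ω : BondConfig V | ¬ (openGraph ω).Reachable a₁ a} ∩ openConn o a₁ ∩
              {ω | ¬ (openGraph ω).Reachable a₁ a₂}) +
            θ * (prodBernoulli w).real ({ω : BondConfig V | ¬ (openGraph ω).Reachable a₁ a} ∩ openConn o a₁ ∩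
              openConn a₁ a₂)) *
          (prodBernoulli w).real ({ω : BondConfig V | ¬ (openGraph ω).Reachable a₁ a} ∩
            {ω | openEdgeCluster ω a₁ ∈ 𝒜}) +
        (prodBernoulli w).real {ω : BondConfig V | ¬ (openGraph ω).Reachable a₁ a} *
          ((prodBernoulli w).real ({ω : BondConfig V | ¬ (openGraph ω).Reachable a₂ a} ∩ openConn o a₂ ∩
              {ω | ¬ (openGraph ω).Reachable a₁ a₂}) +
            (1 - θ) * (prodBernoulli w).real ({ω : BondConfig V | ¬ (openGraph ω).Reachable a₂ a} ∩
              openConn o a₂ ∩ openConn a₁ a₂)) *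
          (prodBernoulli w).real ({ω : BondConfig V | ¬ (openGraph ω).Reachable a₂ a} ∩
            {ω | openEdgeCluster ω a₂ ∈ 𝒜}) ≤
      (prodBernoulli w).real {ω : BondConfig V | ¬ (openGraph ω).Reachable a₁ a} *
        (prodBernoulli w).real {ω : BondConfig V | ¬ (openGraph ω).Reachable a₂ a} *
        (prodBernoulli w).real ((openConn o a₁ ∪ openConn o a₂) ∩
          {ω : BondConfig V | ¬ (openGraph ω).Reachable o a} ∩ {ω | openEdgeCluster ω o ∈ 𝒜}) :=
  pair_avoided_dominance_of_cov w o a₁ a₂ a h12 h1a h2a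
    (fun _ h𝒜 => cov_event_of_diagonal w o a₁ a₂ a h12.symm H₁ h𝒜)
    (fun _ h𝒜 => cov_event_of_diagonal w o a₂ a₁ a h12 H₂ h𝒜)

end UnionExchange

end Summit.CriticalPhenomena.PercolationContinuityZ3.Theorems

end
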